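import Literature.MathematicalPhysics.QuantumFieldTheory.Balaban1983to89.B9Eq326LocalInvTowerSliceGradientRow
import Literature.MathematicalPhysics.QuantumFieldTheory.Balaban1983to89.B9Eq342GradientRowComparisonMassUniform

/-!
# `Balaban1983to89.B9Eq326LocalInvTowerSliceGradientRowDiagonal` — T. Bałaban, *Propagators for lattice gauge theories in a background field*, Commun. Math.
# Phys. **99** (1985) 389–434 [Balaban1985BackgroundPropagators] Thm 3.1 (3.42) p. 397, SECOND ENTRY («δ₀, B₀ dependent on d and L only»), read for the tower
# local part `A₀,k = Δ(U) + D_UD*_U + Q_k(U)†(a•Q_k(U))` of (3.26) p. 395 — **THE SLICE-GRADIENT ROW OF `B9Eq326LocalInvTowerSliceGradientRow` READ ON PRINT's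
# DIAGONAL `ηL^{n+1} = 1`, `c₀(L^{n+1})^d = c₁`, `|η|^d∕c₀ ≤ ρ_w` WITH EVERY CONSTANT FREE OF THE HEIGHT: in the small-gauge model `‖U(b) − 1‖ ≤ αη`,
# `‖U(x,μ) − U(x−e_μ,μ)‖ ≤ α′η²`, plaquette letters `‖Re U(∂p) − 1‖, ‖Im U(∂p)‖ ≤ αη²`, level fields `‖Ū^j − 1‖ ≤ ε_j ≤ ε_s r^j`, at site rate `θ = κ₀η` and
# comparison mass `m_c ≥ 2` in the t-FREE windows `4d(cosh κ₀ − 1) ≤ m_c`, `2(2M_φM_φ′α)(e^{κ₀}+1)d(3√2 + 4 sinh κ₀) ≤ √m_c`, given the decayed value row at rate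
# `κ ≤ κ₀`: `‖(D_U(A₀,k⁻¹f)_μ)(b)‖ ≤ 2e^{κ₀}·(2C₁·(1 + ((c_P♭ + m_c) + d(2M_φM_φ′α′ + (2M_φM_φ′α)²) + M_φM_φ′α·m_c∕κ₀)·C_u))·F·e^{−κ·d_m(Πb₊,v)}`,
# `C₁ = (3√2 + 4 sinh κ₀)∕√m_c`, `c_P♭ = 768|DirPair d|M_τM_φ²ρ_wαe^{2κ₀} + |a|M_φ′M_φe^{100d(d+1)L^dA_Q}·2d·(M_φ′M_φe^{√(L^d)√(2d)102(d+1)²L·ε_s∕(1−r)}·2|Option(Fin d × Bool)|√d)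
# ·e^{2dκ₀} + (d−1)·4M_φM_φ′α·e^{2κ₀}` — NO `n`, `η`, `m`, `c₀`, `c₁`** (the slice twin of this lineage's (GTD) `B9Eq342GreenPrimeTowerGradientRowDiagonal`; the bracket is
# ne9-leaf-03's (DVT) §2's with `ΣB_ν ↦ B_{b.2}`; their (DVTD) carries its own bracket); NE9 owner INTENT-3 gen 96

statement-level skeleton of published theorems with citation tags; proofs where landed; nothing here is a claim about the Yang–Mills mass gap

CITATION HEADER (lean-in-tree rule).  Audit cell `pub-balaban`, sub-cell `t4`, BINDER row NE9; filed by the NE9 OWNER lineage `b2b-balaban-t4-ne9-p1` (gen 96).  SOURCE READ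
first-hand in the held text layer [Balaban1985BackgroundPropagators] (`paper:balaban1985-cmp99-background-propagators`): p. 396 (3.35) (the sizes `|A| < O(1)Mα₀(L^jη)⁻¹`,
`|∇^ηA| < O(1)Mα₀(L^jη)⁻²`, the plaquette size); p. 397 Thm 3.1 («B₀ dependent on d and L only») and (3.42); p. 426 Thm 3.13.  Print's random-walk proof is NOT reproduced;
this file is [folklore] real arithmetic BY NAME over ne9-leaf-05's (K37) `B9Eq342GradientRowComparisonMassUniform` (`window_of_tfree_window`, `mul_weighted_row_le_uniform`,
`uniform_const_le_of_two_le`).  Nothing printed is a hypothesis except the model letters.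

WHAT IS PROVED (sorry-free; proof lane — no `def`; [folklore]).  §0 private `bracket_le` (real bookkeeping); §1 **`norm_covDerivL2K_slice_localInvK_le_bigBlockLetter_diagonal`** — the
parent's §1 at `θ := κ₀η`, `m_c`, `ε_t := αη`, `a_U := α′η²`, `δ := αη²`, `β := 2 sinh θ∕(m_c − 2dη⁻²(cosh θ − 1))`, `κ′ := κ₀`, `C := C_W(m_c, κ₀, 1)`, `K := C√m_c`,
then `η⁻¹·η = 1` (`|η⁻¹|·αη = α`, `η⁻²·α′η² = α′`, `‖η⁻¹‖²·αη² = α`), `|η|^d∕c₀ ≤ ρ_w`, `√(c₀·d·(L^{n+1})^d) = √d·√c₁`, `sinh θ ≥ θ` (`b∕β ≤ M_φM_φ′α·m_c∕κ₀`),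
`η⁻¹·B_ν ≤ C_W ≤ C₁`, `e^{κ₀η(L^{n+1}−1)} ≤ e^{κ₀}`, `e^{κ₀ηd(2L^{n+1}−1)} ≤ e^{2dκ₀}`; `2 ≤ L`, `1 ≤ d` give `N_ν ≥ 2`, `N_ν ≥ η⁻¹`; the `covGrad` reading
(`‖(∇_U A₀,k⁻¹f)(b, μ)‖`, `B9Eq33CovDerivVector.covGrad`) is one line by (VGT-a) `norm_covGrad_apply_le_of_slice` and is stated in the companion `…Closed`.  The one
`set_option maxHeartbeats 400000` covers the size of the displayed closed form (as (GTD), (K60)), not a search.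
HONEST SCOPE.  DISPLAYED: the decayed value row (`C_u`, `κ ≤ κ₀`: (EA0S)∕(ECL)), the positivity `hpos₀`, (T) contractions, the big-block family `P_y`, the MODEL letters
and the two t-free windows — NOT a smallness of `α` in substance (for EVERY `α` both hold with `m_c` large, at the price of the factor `m_c` inside the constant;
the companion `…Closed` fixes `m_c` and caps `α`); the constant is crude; whether print's class (3.35) admits the global small gauge is the model's matter
(«WALLED ON A MODEL»); nothing of [B9] Thm 3.1∕3.3∕3.11∕3.13 is asserted, valued or discharged.  NOT summit progress (cell pub-balaban: NE9 NOT PRINTED ∕ NOT PROVED;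
«NE9 ⇐ the named binders»; row WALLED ON A MODEL (O-NE9-1; #5 UNRULED); spine PROVED 0∕9; rung (B)+1 on a finite T⁴ — NOT infinite volume, NOT mass gap, NOT BetaPertH, NOT
Clay).  HONEST DEPENDENCY (cell line): continuum YM on T⁴ ⇐ BetaPertH ∧ nine spine estimates (0/9 proved); BetaPertH ⇐ (D1) ∧ (D4) ∧ CAP+tail; G-an2-4 gates asym, D1
and NE2/3/4.  NEW file; nothing modified.  Net new unproved facts: 0.
-/

noncomputable section

set_option autoImplicit false

open scoped BigOperators InnerProductSpace

namespace Literature.MathematicalPhysics.QuantumFieldTheory.Balaban1983to89.B9Eq326LocalInvTowerSliceGradientRowDiagonal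

open B4Sect5Torus (TSite tdist)
open B9SectCLatticeCarrier (Bond DirPair bpos btgt shift unshift)
open B4TorusKernel.MultiPeriod (circAbs)
open B9Eq311L2Pairing (WL2)
open B11Eq103H1Complex (SiteL2K BondL2K covDivL2K covDerivL2K greenK)
open B9Eq310HessianOperator (adTransportW curvOp hessOp)
open B9Eq310DeltaPrime (reHol imHol)
open B7Prop1Explicit (U1 Wcx boxVec)
open B9Eq319QprimeTorus (fineP blockCoord)
open B9Eq315QTorus (perCfg cornerSite)
open B9Eq315QTower (towerP UlevOf towerP_apply)
open B9Eq316TowerFlatIsOneStep (towerP_eq_fineP_pow siteCast)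
open B9Eq326OperatorTower (QkW)
open B9Eq342GradientRowComparisonMassUniform (window_of_tfree_window mul_weighted_row_le_uniform uniform_const_le_of_two_le)
open B9Eq326LocalInvTowerSliceGradientRow (norm_covDerivL2K_slice_localInvK_le_bigBlockLetter)

variable {d : ℕ} (L : ℕ) [NeZero L] (m : Fin d → ℕ) [∀ i, NeZero (m i)] (n : ℕ)

/-! ## §0 Real bookkeeping -/
/-- the bracket of the parent's §1 against t-free letters: `t·B ≤ C₁`, `c_P ≤ c_P♭`, `b∕β ≤ Q` (private real bookkeeping). [folklore] -/
private theorem bracket_le {t B C₁ M M' cP cP' mc X bb β Q Cu F E : ℝ} (ht : 0 ≤ t) (hB : 0 ≤ B) (htB : t * B ≤ C₁) (hM0 : 0 ≤ M) (hM : M ≤ M')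
    (hcP : cP ≤ cP') (hQ : bb / β ≤ Q) (hCu : 0 ≤ Cu) (hF : 0 ≤ F) (hE : 0 ≤ E) (hin : 0 ≤ (cP + mc) + X + bb / β) :
    M * ((2 * t) + (2 * (t * ((cP + mc) + X) + t * bb / β) * Cu)) * B * F * E ≤ M' * (2 * C₁ * (1 + ((cP' + mc) + X + Q) * Cu)) * F * E := by
  have e : M * ((2 * t) + (2 * (t * ((cP + mc) + X) + t * bb / β) * Cu)) * B * F * E =
      (M * (2 * (1 + (((cP + mc) + X) + bb / β) * Cu))) * (t * B) * (F * E) := by ring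
  have hin' : 0 ≤ (cP' + mc) + X + Q := by linarith
  have h1' : ((cP + mc) + X) + bb / β ≤ (cP' + mc) + X + Q := by linarith
  have h1 : 1 + (((cP + mc) + X) + bb / β) * Cu ≤ 1 + ((cP' + mc) + X + Q) * Cu := by
    linarith [mul_le_mul_of_nonneg_right h1' hCu]
  have h0 : 0 ≤ 1 + (((cP + mc) + X) + bb / β) * Cu := add_nonneg zero_le_one (mul_nonneg hin hCu)
  have h0' : 0 ≤ 1 + ((cP' + mc) + X + Q) * Cu := add_nonneg zero_le_one (mul_nonneg hin' hCu)
  have hM'0 : 0 ≤ M' := hM0.trans hM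
  have h2 : M * (2 * (1 + (((cP + mc) + X) + bb / β) * Cu)) ≤ M' * (2 * (1 + ((cP' + mc) + X + Q) * Cu)) :=
    mul_le_mul hM (mul_le_mul_of_nonneg_left h1 (by norm_num)) (mul_nonneg (by norm_num) h0) hM'0
  have hR0 : 0 ≤ M' * (2 * (1 + ((cP' + mc) + X + Q) * Cu)) := mul_nonneg hM'0 (mul_nonneg (by norm_num) h0')
  rw [e]
  calc (M * (2 * (1 + (((cP + mc) + X) + bb / β) * Cu))) * (t * B) * (F * E)
      ≤ (M' * (2 * (1 + ((cP' + mc) + X + Q) * Cu))) * C₁ * (F * E) :=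
        mul_le_mul_of_nonneg_right (mul_le_mul h2 htB (mul_nonneg ht hB) hR0) (mul_nonneg hF hE)
    _ = M' * (2 * C₁ * (1 + ((cP' + mc) + X + Q) * Cu)) * F * E := by ring

/-! ## §1 On print's diagonal: every letter height-free -/

section Diagonal

variable {𝔸 : Type*} [NormedRing 𝔸] [StarRing 𝔸] [NormedAlgebra ℂ 𝔸] [StarModule ℂ 𝔸] [CompleteSpace 𝔸] [NormOneClass 𝔸]
  {W : Type*} [NormedAddCommGroup W] [InnerProductSpace ℂ W] [FiniteDimensional ℂ W] (φ : W ≃ₗ[ℂ] 𝔸) {c₀ c₁ : ℝ} [Fact (0 < c₀)] [Fact (0 < c₁)]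
  {η : ℝ} (U : Bond d (towerP L m (n + 1)) → 𝔸ˣ) (hL : 1 ≤ L) (αU : ℕ → ℝ) (hα0 : ∀ j, 0 ≤ αU j) (hα1 : ∀ j, αU j ≤ 1 / 64)
  (hU1 : ∀ (j : ℕ) (x : B7Prop1Explicit.Site d) (k : Fin d), perCfg (towerP L m (j + 1)) (UlevOf L m (n + 1) U j) x k ∈ U1 𝔸)
  (hreg : ∀ (j : ℕ) (y : TSite d (towerP L m j)) (k : Fin d) (ρ : Fin d → Fin L),
    ‖((Wcx L (perCfg (towerP L m (j + 1)) (UlevOf L m (n + 1) U j)) (cornerSite L y) k (boxVec L ρ) : 𝔸ˣ) : 𝔸) - 1‖ ≤ αU j)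
  {Mφ Mφ' : ℝ} (hMφ : 0 ≤ Mφ) (hφ : ∀ w, ‖φ w‖ ≤ Mφ * ‖w‖) (hMφ' : 0 ≤ Mφ') (hφ' : ∀ X, ‖φ.symm X‖ ≤ Mφ' * ‖X‖) (hstar : ∀ X : 𝔸, ‖star X‖ ≤ ‖X‖)
  (εU : ℕ → ℝ) (hεU : ∀ j, 0 ≤ εU j)
  (hUε : ∀ (j : ℕ) (b : Bond d (towerP L m (j + 1))), ‖(UlevOf L m (n + 1) U j b : 𝔸) - 1‖ ≤ εU j)
  {r εs : ℝ} (hr0 : 0 ≤ r) (hr1 : r < 1) (hεs : 0 ≤ εs) (hεg : ∀ j < n + 1, εU j ≤ εs * r ^ j)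
  (τ : 𝔸 →ₗ[ℂ] ℂ) {Mτ : ℝ} (hτ : ∀ X Y : 𝔸, ‖τ (X * Y)‖ ≤ Mτ * ‖X‖ * ‖Y‖) (hMτ : 0 ≤ Mτ)
  (hUb : ∀ b, U b ∈ U1 𝔸) {α α' : ℝ} (hα : 0 ≤ α) (hα' : 0 ≤ α')
  (hUη : ∀ b, ‖(U b : 𝔸) - 1‖ ≤ α * η)
  (hUa : ∀ (x : TSite d (towerP L m (n + 1))) (μ : Fin d), ‖(U (x, μ) : 𝔸) - (U (unshift μ x, μ) : 𝔸)‖ ≤ α' * η ^ 2)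
  (hRe : ∀ p : B9SectCLatticeCarrier.Plaq d (towerP L m (n + 1)), ‖reHol U p - 1‖ ≤ α * η ^ 2)
  (hIm : ∀ p : B9SectCLatticeCarrier.Plaq d (towerP L m (n + 1)), ‖imHol U p‖ ≤ α * η ^ 2)
  {PB : TSite d m → BondL2K ℂ d (towerP L m (n + 1)) c₀ W →L[ℂ] BondL2K ℂ d (towerP L m (n + 1)) c₀ W}
  (hPB : ∀ (y : TSite d m) (f : BondL2K ℂ d (towerP L m (n + 1)) c₀ W) (b : Bond d (towerP L m (n + 1))),
    WL2.equiv ℂ (fun _ : Bond d (towerP L m (n + 1)) => c₀) W (PB y f) b =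
      if blockCoord (L ^ (n + 1)) m (siteCast (towerP_eq_fineP_pow L m (n + 1)) b.1) = y then
        WL2.equiv ℂ (fun _ : Bond d (towerP L m (n + 1)) => c₀) W f b else 0)
  {κ₀ mc : ℝ} (hκ₀ : 0 < κ₀) (hmc2 : 2 ≤ mc)

set_option maxHeartbeats 400000 in
include hα0 hMφ hφ hMφ' hφ' hstar hεU hUε hr0 hr1 hεs hεg hτ hMτ hUb hα hα' hUη hUa hRe hIm hPB hκ₀ hmc2 in
/-- **THE SLICE-GRADIENT ROW OF `A₀,k⁻¹` ON PRINT's DIAGONAL — EVERY CONSTANT HEIGHT-FREE.**  On the diagonal `ηL^{n+1} = 1`, `c₀(L^{n+1})^d = c₁`,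
`|η|^d∕c₀ ≤ ρ_w` (`2 ≤ L`, `1 ≤ d`, `1 ≤ m_i`), for the tower local part `A₀ = Δ(U) + D_UD*_U + Q_k†(a•Q_k)` (`hA₀`, `hpos₀`), a background with unit-bounded bond
variables, `‖U(b) − 1‖ ≤ αη`, the bond-gradient datum `‖U(x,μ) − U(x−e_μ,μ)‖ ≤ α′η²`, plaquette letters `≤ αη²`, the `Q_k` regularity letters (loop window
`Σ_{j<n+1}α_j ≤ A_Q`, geometric level profile `ε_j ≤ ε_s r^j`), contractive transporters (T), the big-block family `P_y`, a physical rate `κ₀ > 0` and a comparison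
mass `m_c ≥ 2` in the t-FREE windows `4d(cosh κ₀ − 1) ≤ m_c`, `2·(2M_φM_φ′α)(e^{κ₀}+1)·d·(3√2 + 4 sinh κ₀) ≤ √m_c`, a source `f` supported over the bonds of the big block
`v` with `‖f(b)‖ ≤ F` and the decayed value row `‖(A₀⁻¹f)(b)‖ ≤ C_u·F·e^{−κ·d_m(Πb₋,v)}` at a rate `0 ≤ κ ≤ κ₀` (DISPLAYED — (EA0S)∕(ECL) of ne9-leaf-03):
for every component `μ` and every fine bond `b`,
`‖(D_U(A₀⁻¹f)_μ)(b)‖ ≤ 2e^{κ₀}·(2C₁·(1 + ((c_P♭ + m_c) + d(2M_φM_φ′α′ + (2M_φM_φ′α)²) + M_φM_φ′α·m_c∕κ₀)·C_u))·F·e^{−κ·d_m(Πb₊, v)}`, `C₁ = (3√2 + 4 sinh κ₀)∕√m_c`,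
`c_P♭` as in the header — NO `n`, `η`, `m`, `c₀`, `c₁`.  The parent's §1 at `θ := κ₀η`, `ε_t := αη`, `a_U := α′η²`, `δ := αη²`,
`β := 2 sinh θ∕(m_c − 2dη⁻²(cosh θ − 1))`, `κ′ := κ₀`, `C := C_W(m_c, κ₀, 1)`, `K := C·√m_c` ((K37)), then `η⁻¹·η = 1`, `sinh θ ≥ θ`, `e^{κ₀η(L^{n+1}−1)} ≤ e^{κ₀}`,
`e^{κ₀ηd(2L^{n+1}−1)} ≤ e^{2dκ₀}`, `√(c₀dL^{(n+1)d}) = √d·√c₁`, `|η|^d∕c₀ ≤ ρ_w`.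
[cite: Balaban1985BackgroundPropagators, Thm 3.1 (3.42) p.397 («B₀ dependent on d and L only»), (3.3) p.391, (3.26) p.395, (3.35) p.396, (3.49) p.399, Thm 3.13 p.426] -/
theorem norm_covDerivL2K_slice_localInvK_le_bigBlockLetter_diagonal [DecidableEq (Bond d (towerP L m (n + 1)))] (hd : 1 ≤ d) (hL2 : 2 ≤ L)
    (hηL : η * (L : ℝ) ^ (n + 1) = 1) (hw : c₀ * ((L : ℝ) ^ (n + 1)) ^ d = c₁) {ρw : ℝ} (hρ : |η| ^ d / c₀ ≤ ρw)
    (hR : ∀ (b : Bond d (towerP L m (n + 1))) (w : W), ‖adTransportW φ U b w‖ ≤ ‖w‖)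
    (hS : ∀ (b : Bond d (towerP L m (n + 1))) (w : W), ‖adTransportW φ (fun bb => (U bb)⁻¹) b w‖ ≤ ‖w‖)
    (a : ℝ) (A₀ : BondL2K ℂ d (towerP L m (n + 1)) c₀ W →ₗ[ℂ] BondL2K ℂ d (towerP L m (n + 1)) c₀ W)
    (hA₀ : A₀ = hessOp φ η U τ + covDerivL2K ℂ c₀ ((η : ℂ))⁻¹ (adTransportW φ U) ∘ₗ covDivL2K ℂ c₀ ((η : ℂ))⁻¹ (adTransportW φ fun b => (U b)⁻¹) +
      LinearMap.adjoint (QkW L m n φ U hL αU hα1 hU1 hreg (c₀ := c₀) (c₁ := c₁)) ∘ₗ ((a : ℂ) • QkW L m n φ U hL αU hα1 hU1 hreg (c₀ := c₀) (c₁ := c₁)))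
    (hpos₀ : ∀ x : BondL2K ℂ d (towerP L m (n + 1)) c₀ W, x ≠ 0 → 0 < RCLike.re ⟪x, A₀ x⟫_ℂ)
    {AQ : ℝ} (hAQ : ∑ j ∈ Finset.range (n + 1), αU j ≤ AQ)
    (hwin4 : 4 * (d : ℝ) * (Real.cosh κ₀ - 1) ≤ mc)
    (hsmall : 2 * ((2 * Mφ * Mφ' * α) * (Real.exp κ₀ + 1) * (d : ℝ) * ((1 + 2 / 1) * Real.sqrt 2 + 4 * Real.sinh κ₀)) ≤ Real.sqrt mc)
    (v : TSite d m) (f : BondL2K ℂ d (towerP L m (n + 1)) c₀ W) {F Cu κ : ℝ} (hF : 0 ≤ F) (hCu : 0 ≤ Cu) (hκ : 0 ≤ κ) (hκ0 : κ ≤ κ₀)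
    (hfv : ∀ b : Bond d (towerP L m (n + 1)), blockCoord (L ^ (n + 1)) m (siteCast (towerP_eq_fineP_pow L m (n + 1)) b.1) ≠ v → WL2.equiv ℂ (fun _ : Bond d (towerP L m (n + 1)) => c₀) W f b = 0)
    (hfF : ∀ b : Bond d (towerP L m (n + 1)), ‖WL2.equiv ℂ (fun _ : Bond d (towerP L m (n + 1)) => c₀) W f b‖ ≤ F)
    (hudec : ∀ b : Bond d (towerP L m (n + 1)), ‖WL2.equiv ℂ (fun _ : Bond d (towerP L m (n + 1)) => c₀) W (greenK A₀ hpos₀ f) b‖ ≤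
      Cu * F * Real.exp (-(κ * tdist m (blockCoord (L ^ (n + 1)) m (siteCast (towerP_eq_fineP_pow L m (n + 1)) b.1)) v)))
    (μ : Fin d) (bnd : Bond d (towerP L m (n + 1))) :
    ‖WL2.equiv ℂ (fun _ : Bond d (towerP L m (n + 1)) => c₀) W
        (covDerivL2K ℂ c₀ ((η : ℂ))⁻¹ (adTransportW φ U) ((WL2.equiv ℂ (fun _ : TSite d (towerP L m (n + 1)) => c₀) W).symm fun y => WL2.equiv ℂ (fun _ : Bond d (towerP L m (n + 1)) => c₀) W (greenK A₀ hpos₀ f) (y, μ))) bnd‖ ≤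
      2 * Real.exp κ₀ *
        (2 * (((1 + 2 / 1) * Real.sqrt 2 + 4 * Real.sinh κ₀) / Real.sqrt mc) *
          (1 + (((768 * Fintype.card (DirPair d) * Mτ * Mφ ^ 2 * ρw * α * Real.exp κ₀ ^ 2 +
        |a| * (Mφ' * Mφ * Real.exp (100 * d * (d + 1) * (L : ℝ) ^ d * AQ) * ((2 * d : ℕ) : ℝ) *
          ((Mφ' * Mφ * Real.exp (Real.sqrt ((L : ℝ) ^ d) * (Real.sqrt (2 * d) * (102 * (d + 1) ^ 2 * L)) * (εs / (1 - r)))) *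
            (2 * ((Fintype.card (Option (Fin d × Bool)) : ℝ) * Real.sqrt d)))) * Real.exp (2 * (d : ℝ) * κ₀) +
        (d - 1 : ℝ) * (2 * Mφ * Mφ' * (2 * α)) * Real.exp κ₀ ^ 2) + mc) +
            (d : ℝ) * (2 * Mφ * Mφ' * α' + (2 * Mφ * Mφ' * α) * (2 * Mφ * Mφ' * α)) + Mφ * Mφ' * α * mc / κ₀) * Cu)) *
        F * Real.exp (-(κ * tdist m (blockCoord (L ^ (n + 1)) m (siteCast (towerP_eq_fineP_pow L m (n + 1)) (btgt bnd))) v)) := by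
  have hm1 : ∀ i, 1 ≤ m i := fun i => Nat.one_le_iff_ne_zero.mpr (NeZero.ne (m i))
  have hc1 : (0 : ℝ) < c₁ := Fact.out
  have hc0 : (0 : ℝ) < c₀ := Fact.out
  have hmc : 0 < mc := by linarith
  have hsm : 0 < Real.sqrt mc := Real.sqrt_pos.2 hmc
  have hd1 : (0 : ℝ) ≤ (d : ℝ) - 1 := sub_nonneg.mpr (by exact_mod_cast hd)
  have hρw : 0 ≤ ρw := le_trans (by positivity) hρ
  -- the units on the diagonal: `η⁻¹ = L^{n+1} ≥ 1`, `η ≤ 1`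
  have hL1 : (1 : ℝ) ≤ (L : ℝ) := by exact_mod_cast le_trans (by norm_num) hL2
  have hLpow : (1 : ℝ) ≤ (L : ℝ) ^ (n + 1) := one_le_pow₀ hL1
  have hinv : η⁻¹ = (L : ℝ) ^ (n + 1) := inv_eq_of_mul_eq_one_right hηL
  have ht1 : (1 : ℝ) ≤ η⁻¹ := by rw [hinv]; exact hLpow
  have ht0 : (0 : ℝ) < η⁻¹ := by linarith
  have hη : 0 < η := inv_pos.mp ht0
  have hη1 : η ≤ 1 := by
    have h := mul_le_mul_of_nonneg_left hLpow hη.le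
    rw [mul_one, hηL] at h
    exact h
  have hηη : η⁻¹ * η = 1 := inv_mul_cancel₀ hη.ne'
  have habs : |η⁻¹| = η⁻¹ := abs_of_pos ht0
  have hnorm : ‖((η⁻¹ : ℝ) : ℂ)‖ = η⁻¹ := by rw [Complex.norm_real, Real.norm_eq_abs, habs]
  have hnmc : ‖((mc : ℝ) : ℂ)‖ = mc := by rw [Complex.norm_real, Real.norm_eq_abs, abs_of_pos hmc]
  have hn1 : ‖((η : ℂ))⁻¹‖ = η⁻¹ := by rw [norm_inv, Complex.norm_real, Real.norm_eq_abs, abs_of_pos hη]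
  have hnd : ‖((η : ℂ)) ^ d‖ = |η| ^ d := by rw [norm_pow, Complex.norm_real, Real.norm_eq_abs]
  have hn2 : ‖((η : ℂ))⁻¹ * ((η : ℂ))⁻¹‖ = η⁻¹ * η⁻¹ := by rw [norm_mul, hn1]
  -- the site rate `θ = κ₀η`: block rate `θL^{n+1} = κ₀`, `θ ≤ κ₀`
  have ha : 0 ≤ κ₀ * η := mul_nonneg hκ₀.le hη.le
  have hapos : 0 < κ₀ * η := mul_pos hκ₀ hη
  have haL : κ₀ * η * (L : ℝ) ^ (n + 1) = κ₀ := by rw [mul_assoc, hηL, mul_one]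
  have hκa : κ ≤ κ₀ * η * (L : ℝ) ^ (n + 1) := by rw [haL]; exact hκ0
  have haκ : κ₀ * η ≤ κ₀ := mul_le_of_le_one_right hκ₀.le hη1
  have hdiv : κ₀ / η⁻¹ = κ₀ * η := div_inv_eq_mul κ₀ η
  have hexp1 : Real.exp (κ₀ * η) ≤ Real.exp κ₀ := Real.exp_le_exp.mpr haκ
  have hexp1sq : Real.exp (κ₀ * η) ^ 2 ≤ Real.exp κ₀ ^ 2 := pow_le_pow_left₀ (Real.exp_pos _).le hexp1 2
  -- the `cosh` window from the t-free window
  have hlam4 := window_of_tfree_window ht1 hκ₀.le d hwin4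
  rw [hdiv] at hlam4
  have hch : 0 ≤ Real.cosh (κ₀ * η) - 1 := by linarith [Real.one_le_cosh (κ₀ * η)]
  have hX0' : 0 ≤ (d : ℝ) * (η⁻¹ ^ 2 * (Real.cosh (κ₀ * η) - 1)) := by positivity
  have hX1 : 0 ≤ η⁻¹ ^ 2 * (Real.cosh (κ₀ * η) - 1) := by positivity
  have eX : 2 * (d : ℝ) * η⁻¹ ^ 2 * (Real.cosh (κ₀ * η) - 1) = 2 * ((d : ℝ) * (η⁻¹ ^ 2 * (Real.cosh (κ₀ * η) - 1))) := by ring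
  have eX4 : 4 * (d : ℝ) * (η⁻¹ ^ 2 * (Real.cosh (κ₀ * η) - 1)) = 4 * ((d : ℝ) * (η⁻¹ ^ 2 * (Real.cosh (κ₀ * η) - 1))) := by ring
  rw [eX4] at hlam4
  have hlam : 2 * (d : ℝ) * η⁻¹ ^ 2 * (Real.cosh (κ₀ * η) - 1) < mc := by rw [eX]; linarith
  have hm'' : 0 < mc - 2 * (d : ℝ) * η⁻¹ ^ 2 * (Real.cosh (κ₀ * η) - 1) := by linarith
  have hm''le : mc - 2 * (d : ℝ) * η⁻¹ ^ 2 * (Real.cosh (κ₀ * η) - 1) ≤ mc := by rw [eX]; linarith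
  have hm' : 0 < mc - 2 * ((d : ℝ) - 1) * η⁻¹ ^ 2 * (Real.cosh (κ₀ * η) - 1) := by
    have e : 2 * ((d : ℝ) - 1) * η⁻¹ ^ 2 * (Real.cosh (κ₀ * η) - 1) =
        2 * ((d : ℝ) * (η⁻¹ ^ 2 * (Real.cosh (κ₀ * η) - 1))) - 2 * (η⁻¹ ^ 2 * (Real.cosh (κ₀ * η) - 1)) := by ring
    rw [e]; linarith
  -- the torus sides `N_ν = L^{n+1}m_ν ≥ max(2, η⁻¹)`
  have hN : ∀ ν, (towerP L m (n + 1) ν : ℝ) = (L : ℝ) ^ (n + 1) * (m ν : ℝ) := fun ν => by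
    rw [towerP_apply]; push_cast; ring
  have hn : ∀ ν, 2 ≤ towerP L m (n + 1) ν := fun ν => by
    rw [towerP_apply]
    calc 2 = 2 ^ 1 * 1 := by norm_num
      _ ≤ L ^ (n + 1) * m ν := Nat.mul_le_mul (le_trans (Nat.pow_le_pow_right (by norm_num) (Nat.le_add_left 1 n)) (Nat.pow_le_pow_left hL2 _)) (hm1 ν)
  have hLn : ∀ ν : Fin d, (1 : ℝ) * η⁻¹ ≤ (towerP L m (n + 1) ν : ℝ) := fun ν => by
    rw [one_mul, hinv, hN ν]
    have h1 : (1 : ℝ) ≤ (m ν : ℝ) := by exact_mod_cast hm1 ν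
    have h0 : (0 : ℝ) ≤ (L : ℝ) ^ (n + 1) := by positivity
    calc (L : ℝ) ^ (n + 1) = (L : ℝ) ^ (n + 1) * 1 := (mul_one _).symm
      _ ≤ (L : ℝ) ^ (n + 1) * (m ν : ℝ) := mul_le_mul_of_nonneg_left h1 h0
  -- the direction constant's positive floor `β` and the t-free row gain `C_W`
  have hsinh : 0 < Real.sinh (κ₀ * η) := Real.sinh_pos_iff.mpr hapos
  have hβ : 0 < 2 * Real.sinh (κ₀ * η) / (mc - 2 * (d : ℝ) * η⁻¹ ^ 2 * (Real.cosh (κ₀ * η) - 1)) := by positivity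
  have hfirst : ∀ ν : Fin d, 0 ≤ (1 + Real.exp (-(κ₀ * η))) *
      ((1 + 2 * η⁻¹ / (towerP L m (n + 1) ν * Real.sqrt (mc - 2 * ((d : ℝ) - 1) * η⁻¹ ^ 2 * (Real.cosh (κ₀ * η) - 1)))) /
        Real.sqrt ((mc - 2 * ((d : ℝ) - 1) * η⁻¹ ^ 2 * (Real.cosh (κ₀ * η) - 1)) ^ 2 +
          4 * (mc - 2 * ((d : ℝ) - 1) * η⁻¹ ^ 2 * (Real.cosh (κ₀ * η) - 1)) * η⁻¹ ^ 2)) := fun ν => by positivity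
  have hβB : ∀ ν : Fin d, 2 * Real.sinh (κ₀ * η) / (mc - 2 * (d : ℝ) * η⁻¹ ^ 2 * (Real.cosh (κ₀ * η) - 1)) ≤ (fun ν : Fin d => (1 + Real.exp (-(κ₀ * η))) *
        ((1 + 2 * η⁻¹ / (towerP L m (n + 1) ν * Real.sqrt (mc - 2 * ((d : ℝ) - 1) * η⁻¹ ^ 2 * (Real.cosh (κ₀ * η) - 1)))) /
          Real.sqrt ((mc - 2 * ((d : ℝ) - 1) * η⁻¹ ^ 2 * (Real.cosh (κ₀ * η) - 1)) ^ 2 +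
            4 * (mc - 2 * ((d : ℝ) - 1) * η⁻¹ ^ 2 * (Real.cosh (κ₀ * η) - 1)) * η⁻¹ ^ 2)) +
        2 * Real.sinh (κ₀ * η) / (mc - 2 * (d : ℝ) * η⁻¹ ^ 2 * (Real.cosh (κ₀ * η) - 1))) ν :=
    fun ν => le_add_of_nonneg_left (hfirst ν)
  have hCW : 0 ≤ (1 + 2 / (1 * Real.sqrt (mc / 2))) / Real.sqrt (mc / 2) + 4 * Real.sinh κ₀ / mc := by
    have hs : 0 ≤ Real.sinh κ₀ := Real.sinh_nonneg_iff.2 hκ₀.le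
    positivity
  have htB : ∀ ν, ‖((η⁻¹ : ℝ) : ℂ)‖ * (fun ν : Fin d => (1 + Real.exp (-(κ₀ * η))) *
        ((1 + 2 * η⁻¹ / (towerP L m (n + 1) ν * Real.sqrt (mc - 2 * ((d : ℝ) - 1) * η⁻¹ ^ 2 * (Real.cosh (κ₀ * η) - 1)))) /
          Real.sqrt ((mc - 2 * ((d : ℝ) - 1) * η⁻¹ ^ 2 * (Real.cosh (κ₀ * η) - 1)) ^ 2 +
            4 * (mc - 2 * ((d : ℝ) - 1) * η⁻¹ ^ 2 * (Real.cosh (κ₀ * η) - 1)) * η⁻¹ ^ 2)) +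
        2 * Real.sinh (κ₀ * η) / (mc - 2 * (d : ℝ) * η⁻¹ ^ 2 * (Real.cosh (κ₀ * η) - 1))) ν ≤
      (1 + 2 / (1 * Real.sqrt (mc / 2))) / Real.sqrt (mc / 2) + 4 * Real.sinh κ₀ / mc := fun ν => by
    have h := mul_weighted_row_le_uniform η⁻¹ ht1 (m := mc) (κ := κ₀) (n := (towerP L m (n + 1) ν : ℝ)) (L := 1) hmc hκ₀.le one_pos (hLn ν) d hwin4
    rw [hdiv] at h
    rw [hnorm]
    exact h
  have hCle := uniform_const_le_of_two_le (κ := κ₀) (L := (1 : ℝ)) hmc2 hκ₀.le one_pos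
  have hCK : (1 + 2 / (1 * Real.sqrt (mc / 2))) / Real.sqrt (mc / 2) + 4 * Real.sinh κ₀ / mc ≤
      ((1 + 2 / (1 * Real.sqrt (mc / 2))) / Real.sqrt (mc / 2) + 4 * Real.sinh κ₀ / mc) * Real.sqrt mc / Real.sqrt mc :=
    (mul_div_cancel_right₀ _ hsm.ne').symm.le
  -- the model letters in units of `η`: `|η⁻¹|·(αη) = α`
  have hte : |η⁻¹| * (2 * Mφ * Mφ' * (α * η)) = 2 * Mφ * Mφ' * α := by
    rw [habs]
    calc η⁻¹ * (2 * Mφ * Mφ' * (α * η)) = 2 * Mφ * Mφ' * α * (η⁻¹ * η) := by ring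
      _ = 2 * Mφ * Mφ' * α := by rw [hηη, mul_one]
  have hmK : 2 * ((|η⁻¹| * (2 * Mφ * Mφ' * (α * η))) * (Real.exp κ₀ + 1) * (d : ℝ) *
      (((1 + 2 / (1 * Real.sqrt (mc / 2))) / Real.sqrt (mc / 2) + 4 * Real.sinh κ₀ / mc) * Real.sqrt mc)) ≤ Real.sqrt mc := by
    rw [hte]
    have hb0 : 0 ≤ (2 * Mφ * Mφ' * α) * (Real.exp κ₀ + 1) * (d : ℝ) := by positivity
    calc 2 * ((2 * Mφ * Mφ' * α) * (Real.exp κ₀ + 1) * (d : ℝ) *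
          (((1 + 2 / (1 * Real.sqrt (mc / 2))) / Real.sqrt (mc / 2) + 4 * Real.sinh κ₀ / mc) * Real.sqrt mc))
        = 2 * ((2 * Mφ * Mφ' * α) * (Real.exp κ₀ + 1) * (d : ℝ)) *
            (((1 + 2 / (1 * Real.sqrt (mc / 2))) / Real.sqrt (mc / 2) + 4 * Real.sinh κ₀ / mc) * Real.sqrt mc) := by ring
      _ ≤ 2 * ((2 * Mφ * Mφ' * α) * (Real.exp κ₀ + 1) * (d : ℝ)) *
            (((1 + 2 / 1) * Real.sqrt 2 + 4 * Real.sinh κ₀) / Real.sqrt mc * Real.sqrt mc) :=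
          mul_le_mul_of_nonneg_left (mul_le_mul_of_nonneg_right hCle hsm.le) (by positivity)
      _ = 2 * ((2 * Mφ * Mφ' * α) * (Real.exp κ₀ + 1) * (d : ℝ) * ((1 + 2 / 1) * Real.sqrt 2 + 4 * Real.sinh κ₀)) := by
          rw [div_mul_cancel₀ _ hsm.ne']; ring
      _ ≤ Real.sqrt mc := hsmall
  -- the parent's §1 at the diagonal choices
  have hδ0 : 0 ≤ α * η ^ 2 := by positivity
  have hmain := norm_covDerivL2K_slice_localInvK_le_bigBlockLetter L m n φ U hL αU hα0 hα1 hU1 hreg hMφ hφ hMφ' hφ' hstar εU hεU hUε hr0 hr1 hεs hεg τ hτ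
    hMτ hη hUb hδ0 hRe hIm (by positivity : 0 ≤ α * η) (by positivity : 0 ≤ α' * η ^ 2) hUη hUa hPB mc (κ₀ * η) hmc hm1 hd hn hR hS a A₀ hA₀ hpos₀ hw hAQ ha hlam
    v f hF hCu hκ hκa hfv hfF hudec hβ hβB haκ hCW htB hCK hmK μ bnd
  -- read the letters: `η⁻²(α′η²) = α′`, `(η⁻¹αη)² = α²`, `b∕β ≤ M_φM_φ′α·m_c∕κ₀`, `η⁻¹B_ν ≤ C₁`, `e^{θ(L^{n+1}−1)} ≤ e^{κ₀}`, `c_P ≤ c_P♭`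
  have e4 : (d : ℝ) * (η⁻¹ ^ 2 * (2 * Mφ * Mφ' * (α' * η ^ 2) + 2 * Mφ * Mφ' * (α * η) * (2 * Mφ * Mφ' * (α * η)))) =
      (d : ℝ) * (2 * Mφ * Mφ' * α' + (2 * Mφ * Mφ' * α) * (2 * Mφ * Mφ' * α)) := by
    have e : η⁻¹ ^ 2 * (2 * Mφ * Mφ' * (α' * η ^ 2) + 2 * Mφ * Mφ' * (α * η) * (2 * Mφ * Mφ' * (α * η))) =
        (2 * Mφ * Mφ' * α' + (2 * Mφ * Mφ' * α) * (2 * Mφ * Mφ' * α)) * (η⁻¹ * η) ^ 2 := by ring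
    rw [e, hηη, one_pow, mul_one]
  have hδβ : 2 * Mφ * Mφ' * (α * η) / (2 * Real.sinh (κ₀ * η) / (mc - 2 * (d : ℝ) * η⁻¹ ^ 2 * (Real.cosh (κ₀ * η) - 1))) ≤
      Mφ * Mφ' * α * mc / κ₀ := by
    have hsa : κ₀ * η ≤ Real.sinh (κ₀ * η) := Real.self_le_sinh_iff.mpr hapos.le
    rw [div_div_eq_mul_div]
    rw [div_le_div_iff₀ (by positivity) hκ₀]
    have h1 : 2 * Mφ * Mφ' * (α * η) * (mc - 2 * (d : ℝ) * η⁻¹ ^ 2 * (Real.cosh (κ₀ * η) - 1)) ≤ 2 * Mφ * Mφ' * (α * η) * mc :=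
      mul_le_mul_of_nonneg_left hm''le (by positivity)
    have h2 : Mφ * Mφ' * α * mc * (2 * (κ₀ * η)) ≤ Mφ * Mφ' * α * mc * (2 * Real.sinh (κ₀ * η)) :=
      mul_le_mul_of_nonneg_left (by linarith) (by positivity)
    calc 2 * Mφ * Mφ' * (α * η) * (mc - 2 * (d : ℝ) * η⁻¹ ^ 2 * (Real.cosh (κ₀ * η) - 1)) * κ₀
        ≤ 2 * Mφ * Mφ' * (α * η) * mc * κ₀ := mul_le_mul_of_nonneg_right h1 hκ₀.le
      _ = Mφ * Mφ' * α * mc * (2 * (κ₀ * η)) := by ring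
      _ ≤ Mφ * Mφ' * α * mc * (2 * Real.sinh (κ₀ * η)) := h2
  have htBC := (htB bnd.2).trans hCle
  rw [hnorm] at htBC
  have hexp : 2 * Real.exp (κ₀ * η * ((L : ℝ) ^ (n + 1) - 1)) ≤ 2 * Real.exp κ₀ := by
    have h : κ₀ * η * ((L : ℝ) ^ (n + 1) - 1) ≤ κ₀ := by
      have e : κ₀ * η * ((L : ℝ) ^ (n + 1) - 1) = κ₀ * η * (L : ℝ) ^ (n + 1) - κ₀ * η := by ring
      rw [e, haL]; linarith
    linarith [Real.exp_le_exp.mpr h]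
  -- `c_P ≤ c_P♭`: the three zeroth-order letters on the diagonal
  have hT1 : 768 * Fintype.card (DirPair d) * Mτ * Mφ ^ 2 * (‖((η : ℂ)) ^ d‖ / c₀) * ‖((η : ℂ))⁻¹‖ ^ 2 * (α * η ^ 2) * Real.exp (κ₀ * η) ^ 2 ≤
      768 * Fintype.card (DirPair d) * Mτ * Mφ ^ 2 * ρw * α * Real.exp κ₀ ^ 2 := by
    rw [hnd, hn1]
    have e : 768 * Fintype.card (DirPair d) * Mτ * Mφ ^ 2 * (|η| ^ d / c₀) * η⁻¹ ^ 2 * (α * η ^ 2) * Real.exp (κ₀ * η) ^ 2 =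
        (768 * Fintype.card (DirPair d) * Mτ * Mφ ^ 2) * ((|η| ^ d / c₀) * α * (η⁻¹ * η) ^ 2) * Real.exp (κ₀ * η) ^ 2 := by ring
    rw [e, hηη, one_pow, mul_one]
    have hρ0 : 0 ≤ |η| ^ d / c₀ := by positivity
    have h1 : |η| ^ d / c₀ * α ≤ ρw * α := mul_le_mul_of_nonneg_right hρ hα
    calc (768 * Fintype.card (DirPair d) * Mτ * Mφ ^ 2) * (|η| ^ d / c₀ * α) * Real.exp (κ₀ * η) ^ 2
        ≤ (768 * Fintype.card (DirPair d) * Mτ * Mφ ^ 2) * (ρw * α) * Real.exp κ₀ ^ 2 :=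
          mul_le_mul (mul_le_mul_of_nonneg_left h1 (by positivity)) hexp1sq (by positivity) (by positivity)
      _ = _ := by ring
  have hsq : Real.sqrt (c₀ * (d * ((L : ℝ) ^ (n + 1)) ^ d)) = Real.sqrt d * Real.sqrt c₁ := by
    have e : c₀ * (d * ((L : ℝ) ^ (n + 1)) ^ d) = (d : ℝ) * c₁ := by rw [← hw]; ring
    rw [e, Real.sqrt_mul (Nat.cast_nonneg d)]
  have hexp2 : Real.exp (κ₀ * η * (d : ℝ) * ((L : ℝ) ^ (n + 1) * 1 + ((L : ℝ) ^ (n + 1) - 1))) ≤ Real.exp (2 * (d : ℝ) * κ₀) := by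
    refine Real.exp_le_exp.mpr ?_
    have e : κ₀ * η * (d : ℝ) * ((L : ℝ) ^ (n + 1) * 1 + ((L : ℝ) ^ (n + 1) - 1)) = 2 * (d : ℝ) * (κ₀ * η * (L : ℝ) ^ (n + 1)) - (d : ℝ) * (κ₀ * η) := by
      ring
    rw [e, haL]
    have : 0 ≤ (d : ℝ) * (κ₀ * η) := by positivity
    linarith
  have hT2 : |a| * (Mφ' * Mφ * Real.exp (100 * d * (d + 1) * (L : ℝ) ^ d * AQ) * ((2 * d : ℕ) : ℝ) *
          ((Mφ' * Mφ * Real.exp (Real.sqrt ((L : ℝ) ^ d) * (Real.sqrt (2 * d) * (102 * (d + 1) ^ 2 * L)) * (εs / (1 - r)))) / Real.sqrt c₁ *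
            (2 * ((Fintype.card (Option (Fin d × Bool)) : ℝ) * (Real.sqrt (c₀ * (d * ((L : ℝ) ^ (n + 1)) ^ d))))))) *
          Real.exp (κ₀ * η * (d : ℝ) * ((L : ℝ) ^ (n + 1) * 1 + ((L : ℝ) ^ (n + 1) - 1))) ≤
      |a| * (Mφ' * Mφ * Real.exp (100 * d * (d + 1) * (L : ℝ) ^ d * AQ) * ((2 * d : ℕ) : ℝ) *
          ((Mφ' * Mφ * Real.exp (Real.sqrt ((L : ℝ) ^ d) * (Real.sqrt (2 * d) * (102 * (d + 1) ^ 2 * L)) * (εs / (1 - r)))) *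
            (2 * ((Fintype.card (Option (Fin d × Bool)) : ℝ) * Real.sqrt d)))) * Real.exp (2 * (d : ℝ) * κ₀) := by
    have hsc : Real.sqrt c₁ ≠ 0 := (Real.sqrt_pos.2 hc1).ne'
    have e : (Mφ' * Mφ * Real.exp (Real.sqrt ((L : ℝ) ^ d) * (Real.sqrt (2 * d) * (102 * (d + 1) ^ 2 * L)) * (εs / (1 - r)))) / Real.sqrt c₁ *
            (2 * ((Fintype.card (Option (Fin d × Bool)) : ℝ) * (Real.sqrt (c₀ * (d * ((L : ℝ) ^ (n + 1)) ^ d))))) =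
        (Mφ' * Mφ * Real.exp (Real.sqrt ((L : ℝ) ^ d) * (Real.sqrt (2 * d) * (102 * (d + 1) ^ 2 * L)) * (εs / (1 - r)))) *
            (2 * ((Fintype.card (Option (Fin d × Bool)) : ℝ) * Real.sqrt d)) := by
      rw [hsq]; field_simp
    rw [e]
    exact mul_le_mul_of_nonneg_left hexp2 (by positivity)
  have hT3 : ‖((η : ℂ))⁻¹ * ((η : ℂ))⁻¹‖ * ((d - 1 : ℝ) * (2 * Mφ * Mφ' * (2 * (α * η ^ 2))) * Real.exp (κ₀ * η) ^ 2) ≤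
      (d - 1 : ℝ) * (2 * Mφ * Mφ' * (2 * α)) * Real.exp κ₀ ^ 2 := by
    rw [hn2]
    have e : η⁻¹ * η⁻¹ * ((d - 1 : ℝ) * (2 * Mφ * Mφ' * (2 * (α * η ^ 2))) * Real.exp (κ₀ * η) ^ 2) =
        (d - 1 : ℝ) * (2 * Mφ * Mφ' * (2 * α)) * (η⁻¹ * η) ^ 2 * Real.exp (κ₀ * η) ^ 2 := by ring
    rw [e, hηη, one_pow, mul_one]
    exact mul_le_mul_of_nonneg_left hexp1sq (mul_nonneg hd1 (by positivity))
  have hcP : (768 * Fintype.card (DirPair d) * Mτ * Mφ ^ 2 * (‖((η : ℂ)) ^ d‖ / c₀) * ‖((η : ℂ))⁻¹‖ ^ 2 * (α * η ^ 2) * Real.exp (κ₀ * η) ^ 2 +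
        |a| * (Mφ' * Mφ * Real.exp (100 * d * (d + 1) * (L : ℝ) ^ d * AQ) * ((2 * d : ℕ) : ℝ) *
          ((Mφ' * Mφ * Real.exp (Real.sqrt ((L : ℝ) ^ d) * (Real.sqrt (2 * d) * (102 * (d + 1) ^ 2 * L)) * (εs / (1 - r)))) / Real.sqrt c₁ *
            (2 * ((Fintype.card (Option (Fin d × Bool)) : ℝ) * (Real.sqrt (c₀ * (d * ((L : ℝ) ^ (n + 1)) ^ d))))))) *
          Real.exp (κ₀ * η * (d : ℝ) * ((L : ℝ) ^ (n + 1) * 1 + ((L : ℝ) ^ (n + 1) - 1))) +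
        ‖((η : ℂ))⁻¹ * ((η : ℂ))⁻¹‖ * ((d - 1 : ℝ) * (2 * Mφ * Mφ' * (2 * (α * η ^ 2))) * Real.exp (κ₀ * η) ^ 2)) ≤ (768 * Fintype.card (DirPair d) * Mτ * Mφ ^ 2 * ρw * α * Real.exp κ₀ ^ 2 +
        |a| * (Mφ' * Mφ * Real.exp (100 * d * (d + 1) * (L : ℝ) ^ d * AQ) * ((2 * d : ℕ) : ℝ) *
          ((Mφ' * Mφ * Real.exp (Real.sqrt ((L : ℝ) ^ d) * (Real.sqrt (2 * d) * (102 * (d + 1) ^ 2 * L)) * (εs / (1 - r)))) *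
            (2 * ((Fintype.card (Option (Fin d × Bool)) : ℝ) * Real.sqrt d)))) * Real.exp (2 * (d : ℝ) * κ₀) +
        (d - 1 : ℝ) * (2 * Mφ * Mφ' * (2 * α)) * Real.exp κ₀ ^ 2) := add_le_add (add_le_add hT1 hT2) hT3
  have hcP0 : 0 ≤ (768 * Fintype.card (DirPair d) * Mτ * Mφ ^ 2 * (‖((η : ℂ)) ^ d‖ / c₀) * ‖((η : ℂ))⁻¹‖ ^ 2 * (α * η ^ 2) * Real.exp (κ₀ * η) ^ 2 +
        |a| * (Mφ' * Mφ * Real.exp (100 * d * (d + 1) * (L : ℝ) ^ d * AQ) * ((2 * d : ℕ) : ℝ) *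
          ((Mφ' * Mφ * Real.exp (Real.sqrt ((L : ℝ) ^ d) * (Real.sqrt (2 * d) * (102 * (d + 1) ^ 2 * L)) * (εs / (1 - r)))) / Real.sqrt c₁ *
            (2 * ((Fintype.card (Option (Fin d × Bool)) : ℝ) * (Real.sqrt (c₀ * (d * ((L : ℝ) ^ (n + 1)) ^ d))))))) *
          Real.exp (κ₀ * η * (d : ℝ) * ((L : ℝ) ^ (n + 1) * 1 + ((L : ℝ) ^ (n + 1) - 1))) +
        ‖((η : ℂ))⁻¹ * ((η : ℂ))⁻¹‖ * ((d - 1 : ℝ) * (2 * Mφ * Mφ' * (2 * (α * η ^ 2))) * Real.exp (κ₀ * η) ^ 2)) := by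
    have h3 : 0 ≤ ‖((η : ℂ))⁻¹ * ((η : ℂ))⁻¹‖ * ((d - 1 : ℝ) * (2 * Mφ * Mφ' * (2 * (α * η ^ 2))) * Real.exp (κ₀ * η) ^ 2) :=
      mul_nonneg (norm_nonneg _) (mul_nonneg (mul_nonneg hd1 (by positivity)) (by positivity))
    exact add_nonneg (add_nonneg (by positivity) (by positivity)) h3
  -- assemble
  have hBC0 : 0 ≤ (fun ν : Fin d => (1 + Real.exp (-(κ₀ * η))) *
        ((1 + 2 * η⁻¹ / (towerP L m (n + 1) ν * Real.sqrt (mc - 2 * ((d : ℝ) - 1) * η⁻¹ ^ 2 * (Real.cosh (κ₀ * η) - 1)))) /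
          Real.sqrt ((mc - 2 * ((d : ℝ) - 1) * η⁻¹ ^ 2 * (Real.cosh (κ₀ * η) - 1)) ^ 2 +
            4 * (mc - 2 * ((d : ℝ) - 1) * η⁻¹ ^ 2 * (Real.cosh (κ₀ * η) - 1)) * η⁻¹ ^ 2)) +
        2 * Real.sinh (κ₀ * η) / (mc - 2 * (d : ℝ) * η⁻¹ ^ 2 * (Real.cosh (κ₀ * η) - 1))) bnd.2 := hβ.le.trans (hβB bnd.2)
  refine hmain.trans ?_
  rw [hnorm, hnmc, habs, e4]
  have hin : 0 ≤ ((768 * Fintype.card (DirPair d) * Mτ * Mφ ^ 2 * (‖((η : ℂ)) ^ d‖ / c₀) * ‖((η : ℂ))⁻¹‖ ^ 2 * (α * η ^ 2) * Real.exp (κ₀ * η) ^ 2 +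
        |a| * (Mφ' * Mφ * Real.exp (100 * d * (d + 1) * (L : ℝ) ^ d * AQ) * ((2 * d : ℕ) : ℝ) *
          ((Mφ' * Mφ * Real.exp (Real.sqrt ((L : ℝ) ^ d) * (Real.sqrt (2 * d) * (102 * (d + 1) ^ 2 * L)) * (εs / (1 - r)))) / Real.sqrt c₁ *
            (2 * ((Fintype.card (Option (Fin d × Bool)) : ℝ) * (Real.sqrt (c₀ * (d * ((L : ℝ) ^ (n + 1)) ^ d))))))) *
          Real.exp (κ₀ * η * (d : ℝ) * ((L : ℝ) ^ (n + 1) * 1 + ((L : ℝ) ^ (n + 1) - 1))) +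
        ‖((η : ℂ))⁻¹ * ((η : ℂ))⁻¹‖ * ((d - 1 : ℝ) * (2 * Mφ * Mφ' * (2 * (α * η ^ 2))) * Real.exp (κ₀ * η) ^ 2)) + mc) +
      (d : ℝ) * (2 * Mφ * Mφ' * α' + (2 * Mφ * Mφ' * α) * (2 * Mφ * Mφ' * α)) +
      2 * Mφ * Mφ' * (α * η) / (2 * Real.sinh (κ₀ * η) / (mc - 2 * (d : ℝ) * η⁻¹ ^ 2 * (Real.cosh (κ₀ * η) - 1))) := by
    have hq : 0 ≤ 2 * Mφ * Mφ' * (α * η) / (2 * Real.sinh (κ₀ * η) / (mc - 2 * (d : ℝ) * η⁻¹ ^ 2 * (Real.cosh (κ₀ * η) - 1))) :=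
      div_nonneg (by positivity) hβ.le
    have : 0 ≤ (d : ℝ) * (2 * Mφ * Mφ' * α' + (2 * Mφ * Mφ' * α) * (2 * Mφ * Mφ' * α)) := by positivity
    linarith
  exact bracket_le ht0.le hBC0 htBC (by positivity) hexp hcP hδβ hCu hF (Real.exp_pos _).le hin

end Diagonal

end Literature.MathematicalPhysics.QuantumFieldTheory.Balaban1983to89.B9Eq326LocalInvTowerSliceGradientRowDiagonal

end
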